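import Summits.QuantumFields.BalabanUV.Beta.GAN24.DirichletVertexDistV
import Summits.QuantumFields.BalabanUV.Beta.GAN24.DirichletVertexLocate

/-!
# `BalabanUV.Beta.GAN24.DirichletVertexNear` — binder row G-an2-4 / (CONV-C), road P2 PART IV, leaf L14 (the torus transfer), FILE U2:
# AT MOST FOUR VERTEX WINDOWS MEET AT A SITE — the volume-free comparison `ω_V⁻¹ ≤ 5·n/r_V` (unit b2b-balaban-gan24-p2, gen 27, v1)

HONEST FRAMING (cell contract, verbatim): «discharging `BetaPertH` makes Bałaban's UV stability UNCONDITIONAL — a real constructive-QFT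
result; it is NOT the continuum limit and NOT the Clay problem.»  SUPPLIER module under the T⁴-DAG sub-row `T4-U1a.S-NE2-D1-DIRICHLET°`.
`DirichletVertexDistV.inv_omegaV_le` (p246485) compares `ω_V⁻¹ ≤ (1+|V|)·n/r_V` with the CARDINALITY of the family `V` — the volume
enters the ray schedule of the flux binders (LOCATED L27-1 of memo `gen27/L14-END.md`).  THIS FILE removes it: a site `x` lies in the
window `ρ̂_b(x) ≤ n − 1` of at most the FOUR corner vertices `b` of its own block, so for a family with one orientation per vertex
`Σ_{v∈V} invW_v(x) ≤ 4·n/r_V(x)` and `n/r_V ≤ ω_V⁻¹ ≤ 5·n/r_V`.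

## Contents ([folklore]; 0 sorry)
* `near_mem` (a vertex whose window contains `x` is a corner of the block of `x`), `card_near_le_four`, `invW_eq_zero_of_far`,
  **`sum_invW_le_four`**, **`inv_omegaV_le_five`**, **`le_omegaV_five`**.

ABSOLUTE RULE (cell, verbatim): «No internally-minted statement may enter as a cited fact. Every hypothesis is either kernel-proved in
this package or a verbatim quotation of a PUBLISHED theorem with page reference. The manuscript(s) under audit are NOT citable for
their own disputed steps — they are the thing under adjudication; programme-internal (2001/route/tribunal) claims are never citable.»
Nothing printed is a hypothesis.  NOT CLAIMED: the volume-uniform END (next files); NOT NE2, (CONV-C), `BetaPertH`, continuum, Clay.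
«not in print; our proof attempt».  HONEST DEPENDENCY: continuum YM on T⁴ ⇐ BetaPertH ∧ nine spine estimates (0/9 proved); BetaPertH ⇐
(D1) ∧ (D4) ∧ CAP+tail; G-an2-4 gates asym, D1 and NE2/3/4.
-/

noncomputable section

open scoped BigOperators
open Finset

namespace Summit.QuantumFields.BalabanUV.Beta.GAN24.DirichletVertexNear

open Literature.MathematicalPhysics.QuantumFieldTheory.Balaban1983to89.B5Prop11Plancherel (Tor fine unitVec)
open Literature.MathematicalPhysics.QuantumFieldTheory.Balaban1983to89.B5Blocks16 (blockOf)
open DirichletRingCutoff (tIdx one_le_tIdx)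
open DirichletRingHessianWindow (rho)
open DirichletVertexChart
open DirichletVertexEnergy (invW omegaV invW_nonneg omegaV_pos inv_omegaV)
open DirichletVertexDist (rhoT tau tau_le_rhoT one_le_rhoT rhoT_emb exists_chart invW_le)
open DirichletVertexDistV (rV rV_le_n rV_le_rhoT one_le_rV le_inv_omegaV)
open DirichletVertexLocate (TT TT_apply crd_TT starBlk_TT)

variable (n : ℕ) [NeZero n] (M : Fin 2 → ℕ) [hM : ∀ μ, NeZero (M μ)]

/-- the four corners of the block of `x`, as a finset of block vertices. [folklore] -/
def corners (x : Tor (fine n M)) : Finset (Tor M) :=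
  {blockOf n M x, blockOf n M x + unitVec M 0, blockOf n M x + unitVec M 1, blockOf n M x + unitVec M 0 + unitVec M 1}

/-- `|corners x| ≤ 4`. [folklore] -/
theorem card_corners_le (x : Tor (fine n M)) : (corners n M x).card ≤ 4 := by
  unfold corners
  refine (Finset.card_insert_le _ _).trans ?_
  refine (Nat.add_le_add_right (Finset.card_insert_le _ _) 1).trans ?_
  refine (Nat.add_le_add_right (Nat.add_le_add_right (Finset.card_insert_le _ _) 1) 1).trans ?_
  simp

/-- **A VERTEX WHOSE WINDOW CONTAINS `x` IS A CORNER OF THE BLOCK OF `x`**: `ρ̂_b(x) ≤ n − 1 ⟹ b ∈ corners x` (`2 ≤ n`). [folklore] -/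
theorem near_mem (hn : 2 ≤ n) {b : Tor M} {x : Tor (fine n M)} (h : rhoT n M b x ≤ n - 1) : b ∈ corners n M x := by
  obtain ⟨i, j, hx, hi, hj⟩ := exists_chart n M TT b x
  have hti := one_le_tIdx i
  have htj := one_le_tIdx j
  have hi' : tIdx i ≤ (n - 1 : ℕ) := by rw [hi]; exact_mod_cast (tau_le_rhoT n M b 0 x).trans h
  have hj' : tIdx j ≤ (n - 1 : ℕ) := by rw [hj]; exact_mod_cast (tau_le_rhoT n M b 1 x).trans h
  have hib : -(n : ℤ) ≤ i ∧ i < n := by unfold tIdx at hi'; split_ifs at hi' <;> constructor <;> omega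
  have hjb : -(n : ℤ) ≤ j ∧ j < n := by unfold tIdx at hj'; split_ifs at hj' <;> constructor <;> omega
  have hblk : blockOf n M x = starBlk M TT b (sgnPat i j) := by rw [hx]; exact blockOf_emb n M TT b hib.1 hib.2 hjb.1 hjb.2
  -- `b = blockOf x + [¬p 0]·e₀ + [¬p 1]·e₁`
  set p := sgnPat i j with hp
  have hind : (fun ν => if p ν then (0 : ZMod (M ν)) else 1)
      = (if p 0 then (0 : Tor M) else unitVec M 0) + (if p 1 then (0 : Tor M) else unitVec M 1) := by
    funext ν
    have hν : ν = 0 ∨ ν = 1 := by fin_cases ν <;> simp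
    rcases hν with rfl | rfl <;> rcases Bool.eq_false_or_eq_true (p 0) with h0 | h0 <;>
      rcases Bool.eq_false_or_eq_true (p 1) with h1 | h1 <;> simp [h0, h1, unitVec]
  have hb : b = blockOf n M x + ((if p 0 then (0 : Tor M) else unitVec M 0) + (if p 1 then (0 : Tor M) else unitVec M 1)) := by
    rw [← hind, hblk]
    funext ν
    rw [Pi.add_apply, starBlk_TT]
    simp
  unfold corners
  simp only [mem_insert, mem_singleton]
  rw [hb]
  rcases Bool.eq_false_or_eq_true (p 0) with h0 | h0 <;> rcases Bool.eq_false_or_eq_true (p 1) with h1 | h1 <;>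
    simp [h0, h1, add_assoc]

/-- **AT MOST FOUR VERTICES HAVE `x` IN THEIR WINDOW**. [folklore] -/
theorem card_near_le_four (hn : 2 ≤ n) (x : Tor (fine n M)) :
    (univ.filter (fun b : Tor M => rhoT n M b x ≤ n - 1)).card ≤ 4 :=
  (Finset.card_le_card (fun _ hb => near_mem n M hn (mem_filter.mp hb).2)).trans (card_corners_le n M x)

section Family

variable {σ : Fin 2 → Bool} {b : Tor M}

/-- far from the vertex the push-forward weight vanishes: `n ≤ ρ̂_b(x) ⟹ invW_{(σ,b)}(x) = 0` (`M_ν ≥ 2`). [folklore] -/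
theorem invW_eq_zero_of_far (hM2 : ∀ ν, 2 ≤ M ν) {x : Tor (fine n M)} (hx : n ≤ rhoT n M b x) : invW n M (σ, b) (n - 1) x = 0 := by
  unfold invW
  refine Finset.sum_eq_zero fun t ht => Finset.sum_eq_zero fun s hs => ?_
  rw [if_neg]
  intro e
  have hs' := mem_range.mp hs
  have ht' := mem_range.mp ht
  have h := rhoT_emb n M σ b (i := -((n - 1 : ℕ) : ℤ) + s) (j := -((n - 1 : ℕ) : ℤ) + t) (by omega) (by omega) (by omega) (by omega) hM2
  rw [← e] at h
  have hρ : rho (-((n - 1 : ℕ) : ℤ) + s) (-((n - 1 : ℕ) : ℤ) + t) ≤ (n - 1 : ℕ) := by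
    unfold rho tIdx; split_ifs <;> omega
  have : (rhoT n M b x : ℤ) ≤ (n - 1 : ℕ) := by rw [h]; exact hρ
  omega

variable (V : Finset ((Fin 2 → Bool) × Tor M))

/-- **`Σ_{v∈V} invW_v(x) ≤ 4·n/r_V(x)`** for a family with one orientation per vertex (`2 ≤ n`, `M_ν ≥ 2`). [folklore] -/
theorem sum_invW_le_four (hinj : ∀ v ∈ V, ∀ v' ∈ V, v.2 = v'.2 → v = v') (hn : 2 ≤ n) (hM2 : ∀ ν, 2 ≤ M ν)
    (x : Tor (fine n M)) : ∑ v ∈ V, invW n M v (n - 1) x ≤ 4 * ((n : ℝ) / rV n M V x) := by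
  classical
  have hr : (0 : ℝ) < rV n M V x := by exact_mod_cast one_le_rV n M V x
  have hq : (0 : ℝ) ≤ (n : ℝ) / rV n M V x := by positivity
  set V₁ := V.filter (fun v => rhoT n M v.2 x ≤ n - 1) with hV₁
  -- the far vertices contribute nothing
  have hsplit : ∑ v ∈ V, invW n M v (n - 1) x = ∑ v ∈ V₁, invW n M v (n - 1) x := by
    rw [hV₁, Finset.sum_filter]
    refine sum_congr rfl fun v _ => ?_
    split_ifs with h
    · rfl
    · exact invW_eq_zero_of_far n M (σ := v.1) (b := v.2) hM2 (by omega)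
  -- the near ones are at most four
  have hcard : V₁.card ≤ 4 := by
    have h1 : V₁.card = (V₁.image Prod.snd).card := by
      rw [Finset.card_image_of_injOn]
      intro v hv v' hv' h
      exact hinj v (mem_filter.mp hv).1 v' (mem_filter.mp hv').1 h
    rw [h1]
    refine (Finset.card_le_card ?_).trans (card_near_le_four n M hn x)
    intro b' hb'
    obtain ⟨v, hv, rfl⟩ := mem_image.mp hb'
    exact mem_filter.mpr ⟨mem_univ _, (mem_filter.mp hv).2⟩
  rw [hsplit]
  calc ∑ v ∈ V₁, invW n M v (n - 1) x ≤ ∑ v ∈ V₁, (n : ℝ) / rV n M V x := by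
        refine sum_le_sum fun v hv => ?_
        have h := invW_le n M (σ := v.1) (b := v.2) hn hM2 x
        refine h.trans (div_le_div_of_nonneg_left (Nat.cast_nonneg _) hr ?_)
        exact_mod_cast rV_le_rhoT n M V (mem_filter.mp hv).1 x
    _ = V₁.card * ((n : ℝ) / rV n M V x) := by rw [sum_const, nsmul_eq_mul]
    _ ≤ 4 * ((n : ℝ) / rV n M V x) := mul_le_mul_of_nonneg_right (by exact_mod_cast hcard) hq

/-- **`ω_V⁻¹ ≤ 5·n/r_V`** (volume-free). [folklore] -/
theorem inv_omegaV_le_five (hinj : ∀ v ∈ V, ∀ v' ∈ V, v.2 = v'.2 → v = v') (hn : 2 ≤ n) (hM2 : ∀ ν, 2 ≤ M ν) (x : Tor (fine n M)) :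
    (omegaV n M V (n - 1) x)⁻¹ ≤ 5 * ((n : ℝ) / rV n M V x) := by
  rw [inv_omegaV]
  have h := sum_invW_le_four n M V hinj hn hM2 x
  have h1 : (1 : ℝ) ≤ (n : ℝ) / rV n M V x := by
    rw [le_div_iff₀ (by exact_mod_cast one_le_rV n M V x), one_mul]
    exact_mod_cast rV_le_n n M V x
  linarith

/-- **`r_V/(5n) ≤ ω_V`** (volume-free). [folklore] -/
theorem le_omegaV_five (hinj : ∀ v ∈ V, ∀ v' ∈ V, v.2 = v'.2 → v = v') (hn : 2 ≤ n) (hM2 : ∀ ν, 2 ≤ M ν) (x : Tor (fine n M)) :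
    (rV n M V x : ℝ) / (5 * n) ≤ omegaV n M V (n - 1) x := by
  have hω := omegaV_pos n M V (n - 1) x
  have hn' : (0 : ℝ) < n := by exact_mod_cast Nat.pos_of_ne_zero (NeZero.ne n)
  have hr : (0 : ℝ) < rV n M V x := by exact_mod_cast one_le_rV n M V x
  have h := inv_omegaV_le_five n M V hinj hn hM2 x
  rw [div_le_iff₀ (by positivity)]
  have h2 : (omegaV n M V (n - 1) x)⁻¹ * rV n M V x ≤ 5 * n := by
    have := mul_le_mul_of_nonneg_right h hr.le
    rwa [mul_assoc, div_mul_cancel₀ _ hr.ne'] at this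
  calc (rV n M V x : ℝ) = omegaV n M V (n - 1) x * ((omegaV n M V (n - 1) x)⁻¹ * rV n M V x) := by
        rw [← mul_assoc, mul_inv_cancel₀ hω.ne', one_mul]
    _ ≤ omegaV n M V (n - 1) x * (5 * n) := mul_le_mul_of_nonneg_left h2 hω.le

end Family

end Summit.QuantumFields.BalabanUV.Beta.GAN24.DirichletVertexNear

end
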